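import Summits.Ventures.PercRepro.GenQChargeBounds

/-!
# PercRepro — the charging form of the type-`t` balance, `t ≤ 2` (night-4, gen 3; the `t = 1` twin of
`GenQChargeTwo`)

`Jq M G q t = Σ_{B ∈ R_q(G)} wT(B)` with `wT(B) = (q + 2 − t)·w_∞(B) − Φ_q·dem_t(B)`.  For `t ≤ 2` only the BASES can
have `wT(B) < 0` (a spanning non-basis has `m ≤ q − 2`, so `wT ≥ (q + 2 − t)/(q − 1) − Φ_q ≥ 0`), and distributing the
weight of every spanning non-basis in equal shares to the bases it contains gives `Jq M G q t ≥ 0` as soon as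
`wT(B₀) + chargeT(B₀) ≥ 0` for every basis `B₀` (`Jq_nonneg_of_chargeT`).  The charge from the singletons and pairs
of `G ∖ B₀` is a lower bound (`chargeT_ge_singles_add_pairs`), with the singleton share
`≥ ((q + 2 − t)/(q + 2 − #C) − Φ_q·dem_t)/#C` (`single_shareT_ge`) and the pair share
`≥ ((q + 2 − t)/(q + 3 − u) − Φ_q·dem_t)/C(u, 2)`, `u = #(C_x ∪ C_y)` (`pair_shareT_ge`); at `t = 2` these are the
landed forms.
-/

namespace PercRepro.GenQ

open Finset ThmH PerFlat SixFour ThmN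

variable {α : Type*} [DecidableEq α] {M : Matroid α} [M.Finite]

/-- The type-`t` term of `B` in the balance of `G` at level `q`. -/
noncomputable def wT (M : Matroid α) [M.Finite] (G B : Finset α) (q t : ℕ) : ℚ :=
  ((q : ℚ) + 2 - t) * wInf M B - (((q : ℚ) + 2) / ((q : ℚ) + 1)) * dem M G t B

/-- The charge received by a basis `B₀` from the spanning non-bases above it, at type `t`. -/
noncomputable def chargeT (M : Matroid α) [M.Finite] (G : Finset α) (q t : ℕ) (B₀ : Finset α) : ℚ :=
  ∑ B ∈ (Rq M G q).filter (fun B => B.card ≠ q ∧ B₀ ⊆ B), wT M G B q t / nb M G B q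

/-- `Jq M G q t` is the sum of the type-`t` terms. -/
theorem Jq_eq_sum_wT (G : Finset α) (q t : ℕ) : Jq M G q t = ∑ B ∈ Rq M G q, wT M G B q t := by
  rw [Jq_eq_sum_dem]
  rfl

/-- **Double counting at type `t`**: the weight of the spanning non-bases is the total charge of the bases. -/
theorem sum_nonbasis_eq_sum_chargeT (G : Finset α) (q t : ℕ) :
    ∑ B ∈ (Rq M G q).filter (fun B => B.card ≠ q), wT M G B q t = ∑ B₀ ∈ basesOf M G q, chargeT M G q t B₀ := by
  unfold chargeT
  have h : ∀ B ∈ (Rq M G q).filter (fun B => B.card ≠ q),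
      wT M G B q t = ∑ B₀ ∈ (basesOf M G q).filter (fun B₀ => B₀ ⊆ B), wT M G B q t / nb M G B q := by
    intro B hB
    rw [Finset.sum_const, nsmul_eq_mul]
    have hnb : (nb M G B q : ℚ) ≠ 0 := by
      have := one_le_nb (Finset.mem_filter.1 hB).1
      exact_mod_cast (by omega : nb M G B q ≠ 0)
    have hcard : (((basesOf M G q).filter (fun B₀ => B₀ ⊆ B)).card : ℚ) = (nb M G B q : ℚ) := by
      unfold nb
      rfl
    rw [hcard, mul_div_assoc', mul_comm, mul_div_assoc, div_self hnb, mul_one]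
  rw [Finset.sum_congr rfl h, Finset.sum_sigma', Finset.sum_sigma']
  refine Finset.sum_bij' (fun p _ => ⟨p.2, p.1⟩) (fun p _ => ⟨p.2, p.1⟩) ?_ ?_ ?_ ?_ ?_
  · intro p hp
    simp only [Finset.mem_sigma, Finset.mem_filter] at hp ⊢
    exact ⟨hp.2.1, hp.1.1, hp.1.2, hp.2.2⟩
  · intro p hp
    simp only [Finset.mem_sigma, Finset.mem_filter] at hp ⊢
    exact ⟨⟨hp.2.1, hp.2.2.1⟩, hp.1, hp.2.2.2⟩
  · intro p _
    rfl
  · intro p _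
    rfl
  · intro p _
    rfl

/-- **The type-`t` balance is nonnegative when every basis is charged at least its deficit.** -/
theorem Jq_nonneg_of_chargeT (G : Finset α) (q t : ℕ)
    (h : ∀ B₀ ∈ basesOf M G q, 0 ≤ wT M G B₀ q t + chargeT M G q t B₀) : 0 ≤ Jq M G q t := by
  rw [Jq_eq_sum_wT]
  have hsplit : ∑ B ∈ Rq M G q, wT M G B q t =
      ∑ B ∈ (Rq M G q).filter (fun B => B.card = q), wT M G B q t +
        ∑ B ∈ (Rq M G q).filter (fun B => B.card ≠ q), wT M G B q t := by
    rw [← Finset.sum_filter_add_sum_filter_not (Rq M G q) (fun B => B.card = q)]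
  rw [hsplit, sum_nonbasis_eq_sum_chargeT]
  have : ∑ B ∈ (Rq M G q).filter (fun B => B.card = q), wT M G B q t = ∑ B₀ ∈ basesOf M G q, wT M G B₀ q t := rfl
  rw [this, ← Finset.sum_add_distrib]
  exact Finset.sum_nonneg (fun B₀ hB₀ => h B₀ hB₀)

/-- **Only bases can be negative at type `t ≤ 2`**: the term of a spanning non-basis is nonnegative. -/
theorem wT_nonneg_of_card_ne (hs : Simple M) {G B : Finset α} (hG : G ⊆ gr M) {q t : ℕ} (hq : 2 ≤ q) (ht : t ≤ 2)
    (hB : B ∈ Rq M G q) (hc : B.card ≠ q) : 0 ≤ wT M G B q t := by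
  have hw := wInf_ge_of_not_indep hs ((mem_Rq.1 hB).1.trans hG) (mem_Rq.1 hB).2 hq
    (not_indep_of_card_ne_of_mem_Rq hB hc)
  have hq' : (2 : ℚ) ≤ q := by exact_mod_cast hq
  have ht' : (t : ℚ) ≤ 2 := by exact_mod_cast ht
  have hd1 := dem_le_one (M := M) G B t
  have hd0 := dem_nonneg (M := M) G B t
  unfold wT
  have h1 : (0 : ℚ) < (q : ℚ) - 1 := by linarith
  have h2 : (0 : ℚ) < (q : ℚ) + 1 := by linarith
  have hqt : (0 : ℚ) ≤ (q : ℚ) + 2 - t := by linarith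
  have hphi : (0 : ℚ) ≤ ((q : ℚ) + 2) / ((q : ℚ) + 1) := by positivity
  have hkey : ((q : ℚ) + 2 - t) * (1 / ((q : ℚ) - 1)) - ((q : ℚ) + 2) / ((q : ℚ) + 1) ≥ 0 := by
    rw [mul_one_div, ge_iff_le, sub_nonneg, div_le_div_iff₀ h2 h1]
    nlinarith
  nlinarith [mul_le_mul_of_nonneg_left hw hqt, mul_le_mul_of_nonneg_left hd1 hphi]

/-- **The charge dominates the charge from any sub-family** (`t ≤ 2`). -/
theorem chargeT_ge_sum_of_subset (hs : Simple M) {G : Finset α} (hG : G ⊆ gr M) {q t : ℕ} (hq : 2 ≤ q)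
    (ht : t ≤ 2) (B₀ : Finset α) {T : Finset (Finset α)}
    (hT : T ⊆ (Rq M G q).filter (fun B => B.card ≠ q ∧ B₀ ⊆ B)) :
    ∑ B ∈ T, wT M G B q t / nb M G B q ≤ chargeT M G q t B₀ := by
  unfold chargeT
  apply Finset.sum_le_sum_of_subset_of_nonneg hT
  intro B hB _
  rw [Finset.mem_filter] at hB
  exact div_nonneg (wT_nonneg_of_card_ne hs hG hq ht hB.1 hB.2.1) (Nat.cast_nonneg _)

/-- **The charge from the singletons and the pairs of `G ∖ B₀`** at type `t ≤ 2`. -/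
theorem chargeT_ge_singles_add_pairs (hs : Simple M) {G B₀ : Finset α} {q t : ℕ} (hG : G ⊆ gr M)
    (hrG : M.eRk (G : Set α) = (q : ℕ∞)) (hB : B₀ ∈ basesOf M G q) (hq : 2 ≤ q) (ht : t ≤ 2) :
    (∑ x ∈ G \ B₀, wT M G (insert x B₀) q t / nb M G (insert x B₀) q) +
      ∑ P ∈ (G \ B₀).powersetCard 2, wT M G (B₀ ∪ P) q t / nb M G (B₀ ∪ P) q ≤ chargeT M G q t B₀ := by
  obtain ⟨hBG, hr, hc⟩ := mem_basesOf.1 hB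
  set T₁ := (G \ B₀).image (fun x => insert x B₀) with hT₁
  set T₂ := ((G \ B₀).powersetCard 2).image (fun P => B₀ ∪ P) with hT₂
  have hinj₁ : Set.InjOn (fun x => insert x B₀) ((G \ B₀ : Finset α) : Set α) := by
    intro x hx x' hx' hxx'
    simp only at hxx'
    have hxB : x ∉ B₀ := (Finset.mem_sdiff.1 (Finset.mem_coe.1 hx)).2
    have : x ∈ insert x' B₀ := by
      rw [← hxx']
      exact Finset.mem_insert_self x B₀
    rcases Finset.mem_insert.1 this with h | h
    · exact h
    · exact absurd h hxB
  have hinj₂ : Set.InjOn (fun P => B₀ ∪ P) (((G \ B₀).powersetCard 2 : Finset (Finset α)) : Set (Finset α)) := by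
    intro P hP P' hP' hPP'
    have hPsub : P ⊆ G \ B₀ := (Finset.mem_powersetCard.1 (Finset.mem_coe.1 hP)).1
    have hP'sub : P' ⊆ G \ B₀ := (Finset.mem_powersetCard.1 (Finset.mem_coe.1 hP')).1
    have hdis : ∀ {Q : Finset α}, Q ⊆ G \ B₀ → (B₀ ∪ Q) \ B₀ = Q := by
      intro Q hQ
      ext e
      rw [Finset.mem_sdiff, Finset.mem_union]
      constructor
      · rintro ⟨h | h, h'⟩
        · exact absurd h h'
        · exact h
      · intro h
        exact ⟨Or.inr h, (Finset.mem_sdiff.1 (hQ h)).2⟩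
    have := congrArg (fun S => S \ B₀) hPP'
    simp only at this
    rwa [hdis hPsub, hdis hP'sub] at this
  have hdisj : Disjoint T₁ T₂ := by
    rw [Finset.disjoint_left]
    intro S h₁ h₂
    rw [hT₁, Finset.mem_image] at h₁
    rw [hT₂, Finset.mem_image] at h₂
    obtain ⟨x, hx, rfl⟩ := h₁
    obtain ⟨P, hP, hPS⟩ := h₂
    have hxB : x ∉ B₀ := (Finset.mem_sdiff.1 hx).2
    obtain ⟨_, hPc⟩ := union_mem_Rq hrG hB (Finset.mem_powersetCard.1 hP).1
    have h1 := congrArg Finset.card hPS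
    rw [hPc, Finset.card_insert_of_notMem hxB, hc, (Finset.mem_powersetCard.1 hP).2] at h1
    omega
  have hsub : T₁ ∪ T₂ ⊆ (Rq M G q).filter (fun B => B.card ≠ q ∧ B₀ ⊆ B) := by
    intro S hS
    rw [Finset.mem_filter]
    rcases Finset.mem_union.1 hS with h₁ | h₂
    · rw [hT₁, Finset.mem_image] at h₁
      obtain ⟨x, hx, rfl⟩ := h₁
      have hxG : x ∈ G := (Finset.mem_sdiff.1 hx).1
      have hxB : x ∉ B₀ := (Finset.mem_sdiff.1 hx).2
      refine ⟨insert_mem_Rq hrG hB hxG, ?_, Finset.subset_insert x B₀⟩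
      rw [Finset.card_insert_of_notMem hxB, hc]
      omega
    · rw [hT₂, Finset.mem_image] at h₂
      obtain ⟨P, hP, rfl⟩ := h₂
      obtain ⟨hR, hPc⟩ := union_mem_Rq hrG hB (Finset.mem_powersetCard.1 hP).1
      refine ⟨hR, ?_, Finset.subset_union_left⟩
      rw [hPc, (Finset.mem_powersetCard.1 hP).2]
      omega
  have h := chargeT_ge_sum_of_subset hs hG hq ht B₀ hsub
  rw [Finset.sum_union hdisj, hT₁, hT₂, Finset.sum_image hinj₁, Finset.sum_image hinj₂] at h
  exact h

/-- **The share of `B₀` from `B₀ ∪ {x}` at type `t ≤ 2`**: at least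
`((q + 2 − t)/(q + 2 − #C) − Φ_q·dem_t(B₀ ∪ {x}))/#C`. -/
theorem single_shareT_ge (hs : Simple M) {G B₀ : Finset α} {q t : ℕ} (hG : G ⊆ gr M)
    (hrG : M.eRk (G : Set α) = (q : ℕ∞)) (hB : B₀ ∈ basesOf M G q) (hq : 2 ≤ q) (ht : t ≤ 2) {x : α} (hx : x ∈ G)
    (hxB : x ∉ B₀) :
    (((q : ℚ) + 2 - t) / ((q : ℚ) + 2 - (fc M x B₀).card) -
        ((q : ℚ) + 2) / ((q : ℚ) + 1) * dem M G t (insert x B₀)) / (fc M x B₀).card ≤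
      wT M G (insert x B₀) q t / nb M G (insert x B₀) q := by
  have hR := insert_mem_Rq hrG hB hx
  obtain ⟨hBG, hr, hc⟩ := mem_basesOf.1 hB
  have hcard : (insert x B₀).card ≠ q := by
    rw [Finset.card_insert_of_notMem hxB, hc]
    omega
  have hw0 : 0 ≤ wT M G (insert x B₀) q t := wT_nonneg_of_card_ne hs hG hq ht hR hcard
  have hnb := nb_insert_le hG hrG hB hx hxB
  have hnb1 := one_le_nb hR
  have hm := mTr_insert_add_card_fc_le hG hrG hB hx hxB
  have h3 := three_le_card_fc hs (hBG.trans hG) (hG hx) (indep_of_mem_basesOf hB)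
    (mem_closure_of_mem_basesOf hG hrG hB hx) hxB (Finset.card_pos.1 (by omega))
  have hcpos : (0 : ℚ) < (fc M x B₀).card := by exact_mod_cast (by omega : 0 < (fc M x B₀).card)
  have hnbpos : (0 : ℚ) < nb M G (insert x B₀) q := by
    exact_mod_cast (by omega : 0 < nb M G (insert x B₀) q)
  have hnb' : (nb M G (insert x B₀) q : ℚ) ≤ (fc M x B₀).card := by exact_mod_cast hnb
  have hqt : (0 : ℚ) ≤ (q : ℚ) + 2 - t := by
    have : (t : ℚ) ≤ 2 := by exact_mod_cast ht
    linarith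
  have hwlow : ((q : ℚ) + 2 - t) / ((q : ℚ) + 2 - (fc M x B₀).card) -
      ((q : ℚ) + 2) / ((q : ℚ) + 1) * dem M G t (insert x B₀) ≤ wT M G (insert x B₀) q t := by
    unfold wT wInf
    have hm' : (mTr M (insert x B₀) : ℚ) + (fc M x B₀).card ≤ q + 1 := by exact_mod_cast hm
    have hden : (0 : ℚ) < (q : ℚ) + 2 - (fc M x B₀).card := by
      linarith [(Nat.cast_nonneg (mTr M (insert x B₀)) : (0 : ℚ) ≤ _)]
    have hwinf : ((q : ℚ) + 2 - t) / ((q : ℚ) + 2 - (fc M x B₀).card) ≤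
        ((q : ℚ) + 2 - t) * (1 / (1 + (mTr M (insert x B₀) : ℚ))) := by
      rw [mul_one_div]
      exact div_le_div_of_nonneg_left hqt (by positivity) (by linarith)
    linarith
  calc (((q : ℚ) + 2 - t) / ((q : ℚ) + 2 - (fc M x B₀).card) -
        ((q : ℚ) + 2) / ((q : ℚ) + 1) * dem M G t (insert x B₀)) / (fc M x B₀).card ≤
        wT M G (insert x B₀) q t / (fc M x B₀).card := div_le_div_of_nonneg_right hwlow hcpos.le
    _ ≤ wT M G (insert x B₀) q t / nb M G (insert x B₀) q := div_le_div_of_nonneg_left hw0 hnbpos hnb'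

end PercRepro.GenQ
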